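import Summits.ResolutionOfSingularities.KangarooAtlas.MizutaniEdgeDatumBound
import HarnessLib

/-!
# The field dichotomy in Mizutani's own vocabulary: `[k : k^p] ≤ p ⇒` every `B_{P,𝔭}` is a vector group; `[k : k^p] > p ⇔` some is not

Cell `pub-rosobs`, Mizutani enclosure (seat mizutani-encloser-2, gen 5). AI-written; AI review is weaker than expert
review; NOT a resolution-of-singularities theorem (summit relevance C).

The in-house note's Cor. 10.1 (last clauses: "for `[𝕜 : 𝕜^p] ≤ p` there is no scheme of exponent `≥ 1` at all"; "the value `2p^e − 1`
is attained as soon as `[𝕜 : 𝕜^p] ≥ p²`") was landed in Oda's coordinates by encloser-2 g3 (`exponentLE_zero_of_rank_le`,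
`exists_not_exponentLE_zero_iff`, `exponent_dichotomy`).  With Mizutani's Rem. 1.2 now a hypothesis-free theorem
(`isVectorGroup_iff_exponent_eq_zero_holds`, encloser-1 g4) and the edge datum (encloser-2 g5), the same dichotomy reads on
Mizutani's Def. 1.1 objects `B_{P,𝔭} = Spec S/U_+(𝔭)S`:

* **`isVectorGroup_of_rank_le`** — if `Module.rank (k^p) k ≤ p` then EVERY point of every `ℙ^n_k` has a vector group `B_{P,𝔭}`
  (`U_+(𝔭)S` generated by linear forms); `ridgeGeneratedInDegreeOne_of_rank_le` — equivalently its edge datum is `(1, …, 1)`;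
* **`exists_not_isVectorGroup_iff_lt_rank`** — some point of some `ℙ^n_k` has a NON-vector-group `B_{P,𝔭}` iff `p < Module.rank (k^p) k`
  (i.e. `[k : k^p] ≥ p²`: a `p`-independent pair exists);
* `isVectorGroup_dichotomy` — the two cases side by side, the second with Mizutani's extremal `H_e` for every `e ≥ 1`
  (`exponent = e`, `dim B_{P,𝔭} + 1 = 2p^e`, `mizutani_attained_hironaka_of_lt_rank`);
* `isVectorGroup_of_dim_le_p` — Hironaka's original bound «`dim B ≤ p ⇒` vector group» (Mizutani p. 85) as a corollary.

## References

* H. Mizutani, *Hironaka's additive group schemes*, Nagoya Math. J. 52 (1973), Rem. 1.2, Remark 2.10 ("let k be a field such that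
  [k : k^p] ≥ p²"). [Mizutani1973HironakaGroupSchemes]
-/

noncomputable section

open MvPolynomial Literature.AlgebraicGeometry.Resolution Literature.AlgebraicGeometry.Resolution.HironakaScheme

namespace Summit.ResolutionOfSingularities.KangarooAtlas.Mizutani

universe u

section Dichotomy

variable (k : Type u) [Field k] (p : ℕ) [hp : Fact p.Prime] [CharP k p] {n : ℕ}

/-- **`[k : k^p] ≤ p ⇒ B_{P,𝔭}` is a vector group for every point `𝔭` of every `ℙ^n_k`.**
[cite: Mizutani1973HironakaGroupSchemes, Rem. 1.2 and Remark 2.10; in-house note MIZUTANI-PROOF-g59 Cor. 10.1] -/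
theorem isVectorGroup_of_rank_le (hk : Module.rank (frobPow k p 1) k ≤ p) (𝔭 : Ideal (MvPolynomial (Fin (n + 1)) k)) [𝔭.IsPrime]
    (hP : IsPoint k 𝔭) : IsVectorGroup k 𝔭 :=
  (isVectorGroup_iff_exponent_eq_zero_holds k p 𝔭 hP).mpr (exponent_eq_zero_of_rank_le k p 𝔭 hk hP)

/-- The same in the edge datum: `[k : k^p] ≤ p ⇒` the edge datum of `B_{P,𝔭}` is `(1, …, 1)` for every point.
[cite: Mizutani1973HironakaGroupSchemes, Rem. 1.2 and Remark 2.10] -/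
theorem ridgeGeneratedInDegreeOne_of_rank_le (hk : Module.rank (frobPow k p 1) k ≤ p)
    (𝔭 : Ideal (MvPolynomial (Fin (n + 1)) k)) [𝔭.IsPrime] (hP : IsPoint k 𝔭) :
    haveI : ExpChar k p := ExpChar.prime hp.out
    RidgeGeneratedInDegreeOne (ridgeEdgeInv p (bIdeal k 𝔭)) :=
  (ridgeGeneratedInDegreeOne_iff_isVectorGroup k p 𝔭 hP).mpr (isVectorGroup_of_rank_le k p hk 𝔭 hP)

/-- **Some `B_{P,𝔭}` over `k` is NOT a vector group iff `[k : k^p] ≥ p²`** (`p < Module.rank (k^p) k`).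
[cite: Mizutani1973HironakaGroupSchemes, Rem. 1.2 and Remark 2.10 ("[k : k^p] ≥ p²"); in-house note Cor. 10.1] -/
theorem exists_not_isVectorGroup_iff_lt_rank :
    (∃ (n : ℕ) (𝔭 : Ideal (MvPolynomial (Fin (n + 1)) k)) (_ : 𝔭.IsPrime), IsPoint k 𝔭 ∧ ¬ IsVectorGroup k 𝔭) ↔
      (p : Cardinal.{u}) < Module.rank (frobPow k p 1) k := by
  rw [← exists_not_exponentLE_zero_iff k p]
  constructor
  · rintro ⟨n, 𝔭, _, hP, hV⟩
    refine ⟨n, 𝔭, hP, fun h0 => hV ?_⟩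
    exact (isVectorGroup_iff_exponent_eq_zero_holds k p 𝔭 hP).mpr
      (Nat.le_zero.mp ((exponent_le_iff k p 𝔭).mpr h0))
  · rintro ⟨n, 𝔭, hP, h0⟩
    haveI : 𝔭.IsPrime := hP.1
    refine ⟨n, 𝔭, inferInstance, hP, fun hV => h0 ?_⟩
    rw [← exponent_le_iff k p 𝔭, (isVectorGroup_iff_exponent_eq_zero_holds k p 𝔭 hP).mp hV]

/-- **The dichotomy on Mizutani's own objects**: either `[k : k^p] ≤ p` and every `B_{P,𝔭}` over `k` is a vector group, or
`[k : k^p] ≥ p²` and for every `e ≥ 1` some point of some `ℙ^n_k` has `exponent = e` and `dim B_{P,𝔭} + 1 = 2p^e` (Mizutani's `H_e`).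
[cite: Mizutani1973HironakaGroupSchemes, Rem. 1.2 and Remark 2.10] -/
theorem isVectorGroup_dichotomy :
    (Module.rank (frobPow k p 1) k ≤ p ∧
      ∀ (n : ℕ) (𝔭 : Ideal (MvPolynomial (Fin (n + 1)) k)) (_ : 𝔭.IsPrime), IsPoint k 𝔭 → IsVectorGroup k 𝔭) ∨
    ((p : Cardinal.{u}) < Module.rank (frobPow k p 1) k ∧
      ∀ e, 1 ≤ e → ∃ (n : ℕ) (𝔭 : Ideal (MvPolynomial (Fin (n + 1)) k)) (_ : 𝔭.IsPrime), IsPoint k 𝔭 ∧ exponent k p 𝔭 = e ∧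
        ringKrullDim (MvPolynomial (Fin (n + 1)) k ⧸ bIdeal k 𝔭) + 1 = (2 * p ^ e : WithBot ℕ∞)) := by
  rcases le_or_gt (Module.rank (frobPow k p 1) k) p with hle | hlt
  · exact Or.inl ⟨hle, fun n 𝔭 _ hP => isVectorGroup_of_rank_le k p hle 𝔭 hP⟩
  · refine Or.inr ⟨hlt, fun e he => ?_⟩
    obtain ⟨𝔭, h𝔭, hP, hexp, hdim⟩ := mizutani_attained_hironaka_of_lt_rank k p hlt he
    exact ⟨_, 𝔭, h𝔭, hP, hexp, hdim⟩

end Dichotomy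

/-! ## Hironaka's original bound (quoted by Mizutani, p. 85) -/

section Hironaka

variable (k : Type u) [Field k] (p : ℕ) [hp : Fact p.Prime] [CharP k p] {n : ℕ}

/-- **Hironaka 1970 [H5] as quoted by Mizutani p. 85 L8–10: «he showed that if the dimension of `B_{Pⁿ,p}` is not greater than `p`, then it
is a vector group»** — a corollary of Mizutani's `2p − 2` (the tree's `mizutani1973_vectorGroup_of_dim_le_holds`), since `p ≤ 2p − 2` for
`p ≥ 2`. [cite: Mizutani1973HironakaGroupSchemes, p. 85 L8–10 (Hironaka's bound dim ≤ p)] -/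
theorem isVectorGroup_of_dim_le_p (𝔭 : Ideal (MvPolynomial (Fin (n + 1)) k)) [𝔭.IsPrime] (hP : IsPoint k 𝔭)
    (hdim : ringKrullDim (MvPolynomial (Fin (n + 1)) k ⧸ bIdeal k 𝔭) ≤ (p : WithBot ℕ∞)) : IsVectorGroup k 𝔭 := by
  refine mizutani1973_vectorGroup_of_dim_le_holds p k n 𝔭 hP ?_
  have h2 : (p : WithBot ℕ∞) + 2 ≤ (2 * p : WithBot ℕ∞) := by
    have hp2 : p + 2 ≤ 2 * p := by have := hp.out.two_le; omega
    exact_mod_cast hp2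
  exact le_trans (add_le_add_left hdim 2) h2

/-- The same in the edge datum: `dim B_{P,𝔭} ≤ p ⇒` the edge datum is `(1, …, 1)`. [cite: Mizutani1973HironakaGroupSchemes, p. 85 L8–10] -/
theorem ridgeGeneratedInDegreeOne_of_dim_le_p (𝔭 : Ideal (MvPolynomial (Fin (n + 1)) k)) [𝔭.IsPrime] (hP : IsPoint k 𝔭)
    (hdim : ringKrullDim (MvPolynomial (Fin (n + 1)) k ⧸ bIdeal k 𝔭) ≤ (p : WithBot ℕ∞)) :
    haveI : ExpChar k p := ExpChar.prime hp.out
    RidgeGeneratedInDegreeOne (ridgeEdgeInv p (bIdeal k 𝔭)) :=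
  (ridgeGeneratedInDegreeOne_iff_isVectorGroup k p 𝔭 hP).mpr (isVectorGroup_of_dim_le_p k p 𝔭 hP hdim)

end Hironaka

end Summit.ResolutionOfSingularities.KangarooAtlas.Mizutani

end
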